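import Summits.CriticalPhenomena.PercolationContinuityZ3.Theorems.PercNearOneGluingNoHeavyLowerTailChampionStabilityRelay
import HarnessLib

/-!
# `NoHeavyLowerTail` (stmt-CriticalPhenomena-4575) — HUB-MOVE: gluing any non-relay vertex into a relay preserves
# the relay order, and merge stability for a relay partner needs only the pairwise comparison

Route `PercNearOneGluingNoHeavy`, seat `prim-gen-swap` (gen 4).  `μ = prodBernoulli w` on `Fin n`, relays `A`, level
`j`, `π(z) = {a ∈ A : z ↔ a}`, `R_a = {|π(a)| ≤ j}`; `w[s(o,v) ↦ 1]` glues the non-relay vertex `o` into `v`.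

* `HubMove.mergeStability_of_mem_of_le` — the tree's `mergeStability_of_mem` (MS for a RELAY partner `v`) with the
  champion hypothesis weakened to the ONE comparison it uses, `μ_w(R_v) ≤ μ_w(R_c)`: then
  `μ_{w[ov↦1]}(1 ≤ |π(o)| ≤ j) ≤ μ_{w[ov↦1]}(R_c)` (same proof: pull back along `ω ↦ insert s(o,v) ω` and apply
  `Literature…twoObserver_le_of_lonelier`).
* `HubMove.real_update_one_lonely_eq` — after gluing, the observer's small-nonempty event IS the relay's loneliness
  event: `μ_{w[ov↦1]}(1 ≤ |π(o)| ≤ j) = μ_{w[ov↦1]}(R_v)`.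
* `hubMove_relayOrder` — **HUB-MOVE**: for `o ∉ A`, relays `v ≠ c`... precisely `v, c ∈ A`, `w s(o,v) = 0`:
  `μ_w(R_v) ≤ μ_w(R_c) ⟹ μ_{w[ov↦1]}(R_v) ≤ μ_{w[ov↦1]}(R_c)`.  Gluing an arbitrary non-relay vertex (with all its edges,
  Steiner or not) into the relay `v` cannot make `v` overtake any relay that was at least as lonely-likely as `v`.
  This is the monotonicity used slice-by-slice in the star-port reduction of the champion-stability inequality CS₂
  (seat memo SILENT-PORTS.md §9: MS for two star ports when the champion survives one of the stars); numerically it was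
  checked on ≈4 000 (graph, o, v, c) instances at (3,1), (4,1), (5,2), (6,3) before being recognised as a corollary of BHK 2006
  Thm 1.5 via the tree.

No definitions, no named facts, no sorries.
-/

noncomputable section

namespace Summit.CriticalPhenomena.PercolationContinuityZ3.Theorems

open MeasureTheory Set Literature.Probability.LatticeModels Literature.Probability.Percolation
open scoped Classical BigOperators

variable {n : ℕ}

namespace HubMove

open ChampionStability in
/-- **Merge stability for a relay partner, pairwise hypothesis.**  If `o ∉ A`, `v, c ∈ A`, `w s(o,v) = 0` and
`μ_w(R_v) ≤ μ_w(R_c)`, then after gluing `o` to `v`: `μ_{w[ov↦1]}(1 ≤ |π(o)| ≤ j) ≤ μ_{w[ov↦1]}(R_c)`.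
(The tree's `mergeStability_of_mem` with the champion hypothesis replaced by its single use.)
[cite: VandenbergHaggstromKahn2005, Thm. 1.5 (p. 7) — via Literature…twoObserver_le_of_lonelier] -/
theorem mergeStability_of_mem_of_le (w : Sym2 (Fin n) → unitInterval) (A : Finset (Fin n))
    (o v c : Fin n) (j : ℕ) (hvo : v ≠ o) (hc : c ∈ A) (hw : w s(o, v) = 0)
    (hle : (prodBernoulli w).real {ω : BondConfig (Fin n) | (A.filter fun x => ω ∈ openConn v x).card ≤ j} ≤
      (prodBernoulli w).real {ω : BondConfig (Fin n) | (A.filter fun x => ω ∈ openConn c x).card ≤ j}) :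
    (prodBernoulli (Function.update w s(o, v) 1)).real {ω : BondConfig (Fin n) |
        1 ≤ (A.filter fun x => ω ∈ openConn o x).card ∧ (A.filter fun x => ω ∈ openConn o x).card ≤ j} ≤
      (prodBernoulli (Function.update w s(o, v) 1)).real {ω : BondConfig (Fin n) |
        (A.filter fun x => ω ∈ openConn c x).card ≤ j} := by
  have hov : o ≠ v := fun h => hvo h.symm
  set μ₁ := prodBernoulli (Function.update w s(o, v) 1) with hμ₁
  set L₁ : Set (BondConfig (Fin n)) := {ω | 1 ≤ (A.filter fun x => ω ∈ openConn o x).card ∧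
      (A.filter fun x => ω ∈ openConn o x).card ≤ j} with hL₁
  set R₁ : Set (BondConfig (Fin n)) := {ω | (A.filter fun x => ω ∈ openConn c x).card ≤ j} with hR₁
  set C : Set (BondConfig (Fin n)) := openConn o c with hC
  have hsplit : ∀ S : Set (BondConfig (Fin n)), μ₁.real S = μ₁.real (S ∩ C) + μ₁.real (S \ C) :=
    fun S => (measureReal_inter_add_sdiff (μ := μ₁) (s := S) (Set.toFinite C).measurableSet).symm
  have hLC : L₁ ∩ C = R₁ ∩ C := by
    ext ω
    simp only [hL₁, hR₁, hC, mem_inter_iff, mem_setOf_eq]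
    constructor
    · rintro ⟨⟨-, h2⟩, hoc⟩
      have hoc' : (openGraph ω).Reachable o c := hoc
      have heq : (A.filter fun x => ω ∈ openConn c x) = (A.filter fun x => ω ∈ openConn o x) := by
        refine Finset.filter_congr fun x _ => ⟨fun h => ?_, fun h => ?_⟩
        · exact hoc'.trans h
        · exact hoc'.symm.trans h
      rw [heq]
      exact ⟨h2, hoc⟩
    · rintro ⟨h2, hoc⟩
      have hoc' : (openGraph ω).Reachable o c := hoc
      have heq : (A.filter fun x => ω ∈ openConn o x) = (A.filter fun x => ω ∈ openConn c x) := by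
        refine Finset.filter_congr fun x _ => ⟨fun h => ?_, fun h => ?_⟩
        · exact hoc'.symm.trans h
        · exact hoc'.trans h
      rw [heq]
      refine ⟨⟨Finset.card_pos.2 ⟨c, Finset.mem_filter.2 ⟨hc, ?_⟩⟩, h2⟩, hoc⟩
      exact SimpleGraph.Reachable.refl c
  have hLoff : μ₁.real (L₁ \ C) = (prodBernoulli w).real {ω : BondConfig (Fin n) |
      ω ∉ openConn c o ∧ ω ∉ openConn c v ∧
      1 ≤ (A.filter fun z => ω ∈ openConn o z ∨ ω ∈ openConn v z).card ∧
      (A.filter fun z => ω ∈ openConn o z ∨ ω ∈ openConn v z).card ≤ j} := by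
    rw [hμ₁, real_update_one_eq w hw]
    congr 1
    ext ω
    simp only [hL₁, hC, mem_preimage, mem_sdiff, mem_setOf_eq]
    have hfilt : (A.filter fun x => insert s(o, v) ω ∈ openConn o x) =
        (A.filter fun z => ω ∈ openConn o z ∨ ω ∈ openConn v z) := by
      refine Finset.filter_congr fun x _ => ?_
      exact reachable_insert_left_iff ω hov x
    have hco : insert s(o, v) ω ∈ openConn o c ↔ (ω ∈ openConn c o ∨ ω ∈ openConn c v) := by
      show (openGraph (insert s(o, v) ω)).Reachable o c ↔
        ((openGraph ω).Reachable c o ∨ (openGraph ω).Reachable c v)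
      rw [SimpleGraph.reachable_comm]
      exact reachable_insert_to_left_iff ω hov c
    rw [hfilt, hco]
    tauto
  have hRoff : μ₁.real (R₁ \ C) = (prodBernoulli w).real {ω : BondConfig (Fin n) |
      ω ∉ openConn c o ∧ ω ∉ openConn c v ∧ (A.filter fun z => ω ∈ openConn c z).card ≤ j} := by
    rw [hμ₁, real_update_one_eq w hw]
    congr 1
    ext ω
    simp only [hR₁, hC, mem_preimage, mem_sdiff, mem_setOf_eq]
    have hco : insert s(o, v) ω ∈ openConn o c ↔ (ω ∈ openConn c o ∨ ω ∈ openConn c v) := by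
      show (openGraph (insert s(o, v) ω)).Reachable o c ↔
        ((openGraph ω).Reachable c o ∨ (openGraph ω).Reachable c v)
      rw [SimpleGraph.reachable_comm]
      exact reachable_insert_to_left_iff ω hov c
    rw [hco]
    constructor
    · rintro ⟨hcard, hnot⟩
      have hco' : ¬ (openGraph ω).Reachable c o := fun h => hnot (Or.inl h)
      have hcv' : ¬ (openGraph ω).Reachable c v := fun h => hnot (Or.inr h)
      have hfilt : (A.filter fun x => insert s(o, v) ω ∈ openConn c x) =
          (A.filter fun z => ω ∈ openConn c z) := by
        refine Finset.filter_congr fun x _ => ?_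
        exact reachable_insert_iff_of_not ω hov hco' hcv' x
      rw [hfilt] at hcard
      exact ⟨hco', hcv', hcard⟩
    · rintro ⟨hco', hcv', hcard⟩
      have hfilt : (A.filter fun x => insert s(o, v) ω ∈ openConn c x) =
          (A.filter fun z => ω ∈ openConn c z) := by
        refine Finset.filter_congr fun x _ => ?_
        exact reachable_insert_iff_of_not ω hov hco' hcv' x
      rw [hfilt]
      exact ⟨hcard, fun h => h.elim hco' hcv'⟩
  have key := twoObserver_le_of_lonelier w A o v c j hle
  rw [hsplit L₁, hsplit R₁, hLC, hLoff, hRoff]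
  linarith

open ChampionStability in
/-- After gluing `o` to the relay `v` (weight-0 pair raised to 1), the observer's small-nonempty event and the
relay's loneliness event have the same probability: `μ_{w[ov↦1]}(1 ≤ |π(o)| ≤ j) = μ_{w[ov↦1]}(|π(v)| ≤ j)`
(both pull back along `ω ↦ insert s(o,v) ω` to `{|π(o) ∪ π(v)| ≤ j}`, which contains `v`). [this file] -/
theorem real_update_one_lonely_eq (w : Sym2 (Fin n) → unitInterval) (A : Finset (Fin n))
    (o v : Fin n) (j : ℕ) (hvo : v ≠ o) (hv : v ∈ A) (hw : w s(o, v) = 0) :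
    (prodBernoulli (Function.update w s(o, v) 1)).real {ω : BondConfig (Fin n) |
        1 ≤ (A.filter fun x => ω ∈ openConn o x).card ∧ (A.filter fun x => ω ∈ openConn o x).card ≤ j} =
      (prodBernoulli (Function.update w s(o, v) 1)).real {ω : BondConfig (Fin n) |
        (A.filter fun x => ω ∈ openConn v x).card ≤ j} := by
  have hov : o ≠ v := fun h => hvo h.symm
  rw [real_update_one_eq w hw, real_update_one_eq w hw]
  congr 1
  ext ω
  simp only [mem_preimage, mem_setOf_eq]
  have hfo : (A.filter fun x => insert s(o, v) ω ∈ openConn o x) =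
      (A.filter fun z => ω ∈ openConn o z ∨ ω ∈ openConn v z) := by
    refine Finset.filter_congr fun x _ => ?_
    exact reachable_insert_left_iff ω hov x
  have hsw : (s(v, o) : Sym2 (Fin n)) = s(o, v) := Sym2.eq_swap
  have hfv : (A.filter fun x => insert s(o, v) ω ∈ openConn v x) =
      (A.filter fun z => ω ∈ openConn o z ∨ ω ∈ openConn v z) := by
    refine Finset.filter_congr fun x _ => ?_
    have h := reachable_insert_left_iff ω hvo x
    rw [hsw] at h
    show (openGraph (insert s(o, v) ω)).Reachable v x ↔ (ω ∈ openConn o x ∨ ω ∈ openConn v x)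
    rw [h]
    show ((openGraph ω).Reachable v x ∨ (openGraph ω).Reachable o x) ↔
      ((openGraph ω).Reachable o x ∨ (openGraph ω).Reachable v x)
    exact Or.comm
  rw [hfo, hfv]
  constructor
  · rintro ⟨-, h⟩
    exact h
  · intro h
    refine ⟨Finset.card_pos.2 ⟨v, Finset.mem_filter.2 ⟨hv, Or.inr ?_⟩⟩, h⟩
    exact (SimpleGraph.Reachable.refl v : (openGraph ω).Reachable v v)

end HubMove

open HubMove in
/-- **HUB-MOVE (gluing a non-relay vertex into a relay preserves the relay order).**  For bond percolation with
arbitrary edge probabilities on `Fin n`, relays `A`, a level `j`, a vertex `o` and relays `v, c ∈ A` with `v ≠ o` and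
`w s(o,v) = 0`: if `μ_w(|π(v)| ≤ j) ≤ μ_w(|π(c)| ≤ j)`, then the same comparison holds after gluing `o` into `v`,
`μ_{w[s(o,v)↦1]}(|π(v)| ≤ j) ≤ μ_{w[s(o,v)↦1]}(|π(c)| ≤ j)` — whatever the neighbourhood of `o` (relays or Steiner vertices).
Proof: `real_update_one_lonely_eq` + `mergeStability_of_mem_of_le`.
[cite: VandenbergHaggstromKahn2005, Thm. 1.5 (p. 7) — corollary via Literature…twoObserver_le_of_lonelier] -/
theorem hubMove_relayOrder (w : Sym2 (Fin n) → unitInterval) (A : Finset (Fin n)) (o v c : Fin n) (j : ℕ)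
    (hvo : v ≠ o) (hv : v ∈ A) (hc : c ∈ A) (hw : w s(o, v) = 0)
    (hle : (prodBernoulli w).real {ω : BondConfig (Fin n) | (A.filter fun x => ω ∈ openConn v x).card ≤ j} ≤
      (prodBernoulli w).real {ω : BondConfig (Fin n) | (A.filter fun x => ω ∈ openConn c x).card ≤ j}) :
    (prodBernoulli (Function.update w s(o, v) 1)).real {ω : BondConfig (Fin n) |
        (A.filter fun x => ω ∈ openConn v x).card ≤ j} ≤
      (prodBernoulli (Function.update w s(o, v) 1)).real {ω : BondConfig (Fin n) |
        (A.filter fun x => ω ∈ openConn c x).card ≤ j} := by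
  rw [← real_update_one_lonely_eq w A o v j hvo hv hw]
  exact mergeStability_of_mem_of_le w A o v c j hvo hc hw hle

end Summit.CriticalPhenomena.PercolationContinuityZ3.Theorems

end
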